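import Summits.ResolutionOfSingularities.ResolutionOfSingularities.Theorems.PurelyInseparableDim4ResConeShadeBound
import Summits.ResolutionOfSingularities.ResolutionOfSingularities.Theorems.PurelyInseparableDim4ResConePolarFree
import HarnessLib
import HarnessLib.Audit.Tags

/-!
# Purely inseparable four-folds — K2(p) IN THREE SLICES: wild shade (`p ≤ d`), power cones (`d < p`,
# `e_G = 3`), binary cones (`d < p`, `e_G = 2`) — every prime

[OURS · counted 0 · cell `res-dim4-pi` · seat res-dim4-p-12 g2 · K2(p) lane (desk WORD #66 (2)).]  Nothing
here proves K2(p), `NoIsolatedTrap p p` or resolution of singularities in dimension ≥ 4 / characteristic `p`.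

Bookkeeping over the landed frame: the located residue (`…ResConeShadeBound`: `1 ≤ d`, `2d + 4 ≤ 3p`,
`2 ≤ e ≤ 4`) splits as
* **slice A («wild shade»)** `p ≤ d ≤ (3p − 4)/2` — the polar kernel is not the directrix there
  (`…VertexTop`: `e = 4 ⇒ d = p`, `g = Σ cᵢ xᵢ^p`); EMPTY for `p ≤ 3`, `d = 5` only at `p = 5`;
* **slice B («power cones»)** `1 ≤ d < p`, `e_G ≡ 3`: every cone is `c_k · ℓ_k^d` (`…PowerCone`), the forms
  persist off the chart letter (p-5 g2 `…FormPersist`) — I-4-7's T33/T43 territory;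
* **slice C («binary cones»)** `1 ≤ d < p`, `e_G ≡ 2`: every cone lies in `K[ℓ₁, ℓ₂]` (`…Adjoin`), satellite
  directions unique/located/alternating (p-5 g2 `…SatUnique/…SatLocated/…YoungBoundary/…Alternation`) —
  I-4-8 / I-1-5 territory;
(`d < p ∧ e_G = 4` is impossible: `…PolarFree.resVertex_ne_top_of_shade_lt`.)
**`noAboveFloorTrap_iff_slices`**: K2(p) ⟺ all three slices are empty over every field of characteristic `p`.
bears_on: LADDER-RESOLUTION:D157-DOOR2 (res-dim4-pi · K2(p)).  Supports stmt-ResolutionOfSingularities-16155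
(helper).
-/

set_option linter.dupNamespace false -- mandated namespace of this single-conjunct summit

noncomputable section

namespace Summit.ResolutionOfSingularities.ResolutionOfSingularities.Theorems.PIDim4

namespace ResCone

open MvPolynomial Finset
open Literature.AlgebraicGeometry.Resolution
open Literature.AlgebraicGeometry.Resolution.CentreBlowup
open Literature.AlgebraicGeometry.Resolution.Hauser2010
open Literature.AlgebraicGeometry.Resolution.HauserPerlega2019

variable {K : Type} [Field K]

/-- In the tame range a full polar kernel cannot occur along a located trap (`0 < d < p` ⇒ `e_G ≠ 4`).
[OURS] [folklore] -/
theorem finrank_resVertex_ne_four_of_shade_lt (p : ℕ) [Fact p.Prime] [CharP K p] [DecidableEq K]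
    {c : ℕ → State K} (hc : ∀ k, IsIsolated p (c k).F ∧ Step0 p (c k) (c (k + 1)))
    (hr0 : ∀ e ∈ (c 0).F.support, (c 0).r ≤ e) {d : ℕ} (hd1 : 1 ≤ d) (hdp : d < p)
    (hshade : (c 0).shade = (d : ℕ∞)) : Module.finrank K (resVertex (c 0)) ≠ 4 := by
  intro h4
  obtain ⟨o, ho, -, -⟩ := BandShade.exists_ordZero_eq p hc 0
  rw [BandShade.shade_eq_coe ho] at hshade
  have hd : o - (c 0).r.degree = d := by exact_mod_cast hshade
  exact resVertex_ne_top_of_shade_lt p ho hr0 (by omega) (by omega) (resVertex_eq_top_of_finrank_eq_four h4)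

/-- **K2(p) IN THREE SLICES** (every prime `p`): `RidgeBudget.NoAboveFloorTrap p p` iff over every field of
characteristic `p` there is (A) no located trap of wild shade `p ≤ d` (`2d + 4 ≤ 3p`, `2 ≤ e ≤ 4`), (B) no
located trap with `1 ≤ d < p` and `e_G ≡ 3` (power cones), (C) none with `1 ≤ d < p` and `e_G ≡ 2`
(binary cones). [OURS] [cite: CossartJannsenSaito2020, Thm. 3.14] -/
theorem noAboveFloorTrap_iff_slices (p : ℕ) [Fact p.Prime] :
    RidgeBudget.NoAboveFloorTrap p p ↔ ∀ (K : Type) [Field K] [CharP K p] [DecidableEq K],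
      (¬ ∃ (c : ℕ → State K) (d e : ℕ), p ≤ d ∧ 2 * d + 4 ≤ 3 * p ∧ 2 ≤ e ∧ e ≤ 4 ∧
          (∀ e' ∈ (c 0).F.support, (c 0).r ≤ e') ∧
          ∀ k, IsIsolated p (c k).F ∧ Step0 p (c k) (c (k + 1)) ∧ ordZero (c k).F ≠ p ∧
            (c k).shade = (d : ℕ∞) ∧ Module.finrank K (resVertex (c k)) = e) ∧
      (¬ ∃ (c : ℕ → State K) (d : ℕ), 1 ≤ d ∧ d < p ∧
          (∀ e' ∈ (c 0).F.support, (c 0).r ≤ e') ∧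
          ∀ k, IsIsolated p (c k).F ∧ Step0 p (c k) (c (k + 1)) ∧ ordZero (c k).F ≠ p ∧
            (c k).shade = (d : ℕ∞) ∧ Module.finrank K (resVertex (c k)) = 3) ∧
      (¬ ∃ (c : ℕ → State K) (d : ℕ), 1 ≤ d ∧ d < p ∧
          (∀ e' ∈ (c 0).F.support, (c 0).r ≤ e') ∧
          ∀ k, IsIsolated p (c k).F ∧ Step0 p (c k) (c (k + 1)) ∧ ordZero (c k).F ≠ p ∧
            (c k).shade = (d : ℕ∞) ∧ Module.finrank K (resVertex (c k)) = 2) := by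
  have hp : 2 ≤ p := (Fact.out : p.Prime).two_le
  constructor
  · intro h K _ _ _
    rw [noAboveFloorTrap_iff_noLocatedTrap] at h
    refine ⟨?_, ?_, ?_⟩
    · rintro ⟨c, d, e, hpd, hd2, he2, he4, hr0, hc⟩
      exact h K ⟨c, d, e, by omega, by omega, he2, he4, hr0, hc⟩
    · rintro ⟨c, d, hd1, hdp, hr0, hc⟩
      exact h K ⟨c, d, 3, hd1, by omega, by omega, by omega, hr0, hc⟩
    · rintro ⟨c, d, hd1, hdp, hr0, hc⟩
      exact h K ⟨c, d, 2, hd1, by omega, le_rfl, by omega, hr0, hc⟩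
  · intro h
    rw [noAboveFloorTrap_iff_noLocatedTrap']
    intro K _ _ _
    rintro ⟨c, d, e, hd1, hd2, he2, he4, hr0, hc⟩
    obtain ⟨hA, hB, hC⟩ := h K
    by_cases hpd : p ≤ d
    · exact hA ⟨c, d, e, hpd, hd2, he2, he4, hr0, hc⟩
    · have hdp : d < p := not_le.mp hpd
      have hc2 : ∀ k, IsIsolated p (c k).F ∧ Step0 p (c k) (c (k + 1)) := fun k => ⟨(hc k).1, (hc k).2.1⟩
      have hne4 := finrank_resVertex_ne_four_of_shade_lt p hc2 hr0 hd1 hdp (hc 0).2.2.2.1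
      have he0 := (hc 0).2.2.2.2
      rcases Nat.lt_or_ge e 3 with he3 | he3
      · have he : e = 2 := by omega
        subst he
        exact hC ⟨c, d, hd1, hdp, hr0, hc⟩
      · rcases Nat.lt_or_ge e 4 with he4' | he4'
        · have he : e = 3 := by omega
          subst he
          exact hB ⟨c, d, hd1, hdp, hr0, hc⟩
        · exact hne4 (by rw [he0]; omega)

end ResCone

end Summit.ResolutionOfSingularities.ResolutionOfSingularities.Theorems.PIDim4

end
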